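import Mathlib.CategoryTheory.Limits.Shapes.Products
import Mathlib.CategoryTheory.Limits.Shapes.FiniteProducts
import Mathlib.CategoryTheory.Limits.Shapes.Countable
import Mathlib.CategoryTheory.Limits.FormalCoproducts.Basic
import Mathlib.CategoryTheory.ObjectProperty.FullSubcategory
import Mathlib.Logic.Equiv.Fin.Basic
import Mathlib.Data.Countable.Basic
import Literature.AlgebraicGeometry.Frobenioids.Categories
import HarnessLib

/-!
# Frobenioids I, §0 p. 16: the residual claims on `C⁰`, `C^⊥`, `C^⊤` — `(D⁰)^⊥ ≃ D`, `(E⁰)^⊤ ≃ E`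

Mochizuki, *The geometry of Frobenioids I: the general theory*, Kyushu J. Math. **62** (2008)
293–400, §0 "Categories", kurims text pp. 15–16 [cite: MochizukiFrdI2008, §0 pp.15-16]. The landed
files `Categories.lean` / `CoproductCompletion.lean` (abc-iut-found) type the vocabulary and list as
"deliberately NOT here" the following printed claims of p. 16, which this file states AND proves:

* "if, in addition, `C` is almost totally epimorphic, then `C⁰` is totally epimorphic" —
  `IsAlmostTotallyEpimorphic.connectedPart` (proved for every almost totally epimorphic `C`; the
  printed standing hypothesis "of finitely or countably connected type" is not used by the argument,
  so the theorem as stated implies the printed one);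
* "there are natural [up to isomorphism] equivalences of categories `(D⁰)^⊥ ⥲ D` … for `D` a category
  of finitely connected type" — the functor `ConnectedPart.glue` ("form the coproduct in `D`") on
  `(D⁰)^⊥ = FiniteCoproductCompletion (ConnectedPart D)` and `glue_isEquivalence_of_isOfFinitelyConnectedType`;
* "`(E⁰)^⊤ ⥲ E` for `E` a category of countably connected type" —
  `glue_isEquivalence_of_isOfCountablyConnectedType`.

On the way: the bijectivity clause of "of finitely (countably) connected type" (typed over `Fin n`-,
resp. `Type`-indexed families) transported to arbitrary finite (countable) index types in any universe
(`IsOfFinitelyConnectedType.bijective_of_finite`, `IsOfCountablyConnectedType.bijective_of_countable`).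

Remaining p. 16 residuals ("`C` totally epimorphic ⇒ `C^⊥`, `C^⊤` almost totally epimorphic";
"`C^⊤` is of countably connected type") need "connected ⇔ one index" from `CoproductCompletionConnected`
and are filed in a sibling once that module lands. No statement of the paper is strengthened.
-/

namespace Literature.AlgebraicGeometry.Frobenioids

open CategoryTheory CategoryTheory.Limits

universe w v u

variable {C : Type u} [Category.{v} C]

/-! ### `C⁰` is totally epimorphic (p. 16) -/

/-- **FrdI §0 p. 16:** "if, in addition, `C` is almost totally epimorphic, then `C⁰` is totally
epimorphic" — an arrow `A → B` of `C⁰` has nonempty (indeed connected) domain and connected codomain,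
so it is an epimorphism of `C`, hence of the full subcategory `C⁰`. (The printed sentence is stated for
`C` of finitely or countably connected type; the proof uses only almost total epimorphicity, so we state
it for every `C`.) [cite: MochizukiFrdI2008, §0 p.16] -/
theorem IsAlmostTotallyEpimorphic.connectedPart (hC : IsAlmostTotallyEpimorphic C) :
    IsTotallyEpimorphic (ConnectedPart C) := by
  refine ⟨fun {A B} f => ⟨fun g h hgh => ?_⟩⟩
  haveI := hC.epi f.hom A.property.1 B.property
  apply ObjectProperty.hom_ext
  exact (cancel_epi f.hom).mp (by
    simpa only [ObjectProperty.FullSubcategory.comp_hom] using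
      congrArg InducedCategory.Hom.hom hgh)

/-! ### The bijectivity clause over arbitrary finite / countable index types -/

/-- The bijectivity clause of "of finitely connected type" (typed for `Fin n`-indexed cofans) holds for
cofans indexed by any finite type: reindex along `ι ≃ Fin n`. [cite: MochizukiFrdI2008, §0 p.15] -/
theorem IsOfFinitelyConnectedType.bijective_of_finite (hC : IsOfFinitelyConnectedType C)
    {ι : Type w} [Finite ι] {X : ι → C} (c : Cofan X) (hc : IsColimit c) (B : C)
    (hB : IsConnectedObj B) :
    Function.Bijective fun p : Σ i, (B ⟶ X i) => p.2 ≫ c.inj p.1 := by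
  haveI := hC.hasFiniteCoproducts
  obtain ⟨n, ⟨e⟩⟩ := Finite.exists_equiv_fin ι
  have hb := hC.bijective _ ((Cofan.isColimitEquivOfEquiv e.symm c) hc) B hB
  exact (Function.Bijective.of_comp_iff (fun p : Σ i, (B ⟶ X i) => p.2 ≫ c.inj p.1)
    (Equiv.sigmaCongrLeft e.symm).bijective).mp hb

/-- The bijectivity clause of "of countably connected type" (typed for index types in `Type`) holds
for cofans indexed by any countable type: reindex along an equivalence with a subtype of `ℕ`.
[cite: MochizukiFrdI2008, §0 p.15] -/
theorem IsOfCountablyConnectedType.bijective_of_countable (hC : IsOfCountablyConnectedType C)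
    {ι : Type w} [Countable ι] {X : ι → C} (c : Cofan X) (hc : IsColimit c) (B : C)
    (hB : IsConnectedObj B) :
    Function.Bijective fun p : Σ i, (B ⟶ X i) => p.2 ≫ c.inj p.1 := by
  haveI := hC.hasCountableCoproducts
  obtain ⟨f, hf⟩ := Countable.exists_injective_nat ι
  let e : ι ≃ Set.range f := Equiv.ofInjective f hf
  have hb := hC.bijective _ ((Cofan.isColimitEquivOfEquiv e.symm c) hc) B hB
  exact (Function.Bijective.of_comp_iff (fun p : Σ i, (B ⟶ X i) => p.2 ≫ c.inj p.1)
    (Equiv.sigmaCongrLeft e.symm).bijective).mp hb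

/-! ### The gluing functor `(D⁰)^⊥ → D`, `(E⁰)^⊤ → E` -/

namespace ConnectedPart

variable (P : ObjectProperty (FormalCoproduct.{w} (ConnectedPart C)))
  [∀ X : P.FullSubcategory, HasCoproduct fun i : X.obj.I => (X.obj.obj i).obj]

/-- The natural functor from a category of formal coproducts `{Aᵢ}` of connected objects of `C` to `C`,
"form the coproduct `∐ Aᵢ` in `C`"; on arrows `(f, {Aᵢ → B_{f(i)}})` it is the induced map of
coproducts (FrdI §0 p. 16, the equivalences `(D⁰)^⊥ ⥲ D`, `(E⁰)^⊤ ⥲ E`).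
[cite: MochizukiFrdI2008, §0 p.16] -/
noncomputable def glue : P.FullSubcategory ⥤ C where
  obj X := ∐ fun i : X.obj.I => (X.obj.obj i).obj
  map {X Y} g := Sigma.desc (f := fun i : X.obj.I => (X.obj.obj i).obj)
    (P := ∐ fun j : Y.obj.I => (Y.obj.obj j).obj)
    fun i => (g.hom.φ i).hom ≫ Sigma.ι (fun j : Y.obj.I => (Y.obj.obj j).obj) (g.hom.f i)
  map_id X := Sigma.hom_ext _ _ fun i => by
    rw [Sigma.ι_desc, Category.comp_id]
    exact Category.id_comp _
  map_comp f g := Sigma.hom_ext _ _ fun i => by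
    rw [Sigma.ι_desc, Sigma.ι_desc_assoc, Category.assoc, Sigma.ι_desc]
    exact Category.assoc _ _ _

/-- The gluing functor on objects: `{Aᵢ} ↦ ∐ Aᵢ`. [cite: MochizukiFrdI2008, §0 p.16] -/
theorem glue_obj (X : P.FullSubcategory) :
    (glue P).obj X = ∐ fun i : X.obj.I => (X.obj.obj i).obj := rfl

/-- The gluing functor on the `i`-th coprojection. [cite: MochizukiFrdI2008, §0 p.16] -/
theorem ι_glue_map {X Y : P.FullSubcategory} (g : X ⟶ Y) (i : X.obj.I) :
    Sigma.ι (fun i : X.obj.I => (X.obj.obj i).obj) i ≫ (glue P).map g =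
      (g.hom.φ i).hom ≫ Sigma.ι (fun j : Y.obj.I => (Y.obj.obj j).obj) (g.hom.f i) :=
  Sigma.ι_desc _ _

/-- Two arrows of formal coproducts of connected objects agree as soon as their components, read as
elements of `Σⱼ Hom(Aᵢ, Bⱼ)` (the printed `Hom` formula of p. 16), agree.
[cite: MochizukiFrdI2008, §0 p.16] -/
theorem hom_ext_of_sigma {X Y : FormalCoproduct.{w} (ConnectedPart C)} {g g' : X ⟶ Y}
    (h : ∀ i, (⟨g.f i, (g.φ i).hom⟩ : Σ j, ((X.obj i).obj ⟶ (Y.obj j).obj)) =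
      ⟨g'.f i, (g'.φ i).hom⟩) : g = g' := by
  obtain ⟨f, φ⟩ := g
  obtain ⟨f', φ'⟩ := g'
  obtain rfl : f = f' := funext fun i => congrArg Sigma.fst (h i)
  have hφ : φ = φ' := by
    funext i
    have hi := (Sigma.mk.inj_iff.mp (h i)).2
    exact InducedCategory.hom_ext (eq_of_heq hi)
  subst hφ
  rfl

/-- The gluing functor is faithful as soon as connected objects of `C` see the coproducts `∐ Bⱼ` as
disjoint unions of `Hom`-sets (injectivity half of the third clause of "of finitely / countably
connected type"). [cite: MochizukiFrdI2008, §0 p.16] -/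
theorem glue_faithful
    (hinj : ∀ (Y : P.FullSubcategory) (B : C), IsConnectedObj B → Function.Injective
      fun p : Σ j, (B ⟶ (Y.obj.obj j).obj) =>
        p.2 ≫ Sigma.ι (fun j : Y.obj.I => (Y.obj.obj j).obj) p.1) :
    (glue P).Faithful where
  map_injective {X Y} := fun {g g'} hgg => by
    apply ObjectProperty.hom_ext
    refine hom_ext_of_sigma fun i => hinj Y (X.obj.obj i).obj (X.obj.obj i).property ?_
    change (g.hom.φ i).hom ≫ _ = (g'.hom.φ i).hom ≫ _
    rw [← ι_glue_map, ← ι_glue_map, hgg]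

/-- The gluing functor is full as soon as every arrow from a connected object into `∐ Bⱼ` factors
through some `Bⱼ` (surjectivity half of the third clause). [cite: MochizukiFrdI2008, §0 p.16] -/
theorem glue_full
    (hsurj : ∀ (Y : P.FullSubcategory) (B : C), IsConnectedObj B → Function.Surjective
      fun p : Σ j, (B ⟶ (Y.obj.obj j).obj) =>
        p.2 ≫ Sigma.ι (fun j : Y.obj.I => (Y.obj.obj j).obj) p.1) :
    (glue P).Full where
  map_surjective {X Y} := fun h => by
    have key : ∀ i, ∃ p : Σ j, ((X.obj.obj i).obj ⟶ (Y.obj.obj j).obj),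
        p.2 ≫ Sigma.ι (fun j : Y.obj.I => (Y.obj.obj j).obj) p.1 =
          Sigma.ι (fun i : X.obj.I => (X.obj.obj i).obj) i ≫ h := fun i =>
      hsurj Y _ (X.obj.obj i).property _
    choose p hp using key
    refine ⟨ObjectProperty.homMk ⟨fun i => (p i).1, fun i => ObjectProperty.homMk (p i).2⟩, ?_⟩
    exact Sigma.hom_ext _ _ fun i => by rw [ι_glue_map]; exact hp i

/-- The value of the gluing functor on a formal coproduct is a coproduct of its (connected) members:
if moreover an object `A` of `C` is a coproduct of a family of connected objects indexed by a type
admitted by `P`, then `A` is in the essential image. [cite: MochizukiFrdI2008, §0 p.16] -/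
theorem mem_essImage_glue_of_cofan {ι : Type w} {A : C} (X : ι → C) (hX : ∀ i, IsConnectedObj (X i))
    (c : Cofan X) (hc : IsColimit c) (e : c.pt ≅ A)
    (hP : P ⟨ι, fun i => ⟨X i, hX i⟩⟩) : (glue P).essImage A := by
  let Xo : P.FullSubcategory := ⟨⟨ι, fun i => ⟨X i, hX i⟩⟩, hP⟩
  refine ⟨Xo, ⟨?_ ≪≫ e⟩⟩
  exact (coproductIsCoproduct fun i : Xo.obj.I => (Xo.obj.obj i).obj).coconePointUniqueUpToIso hc

end ConnectedPart

/-! ### `(D⁰)^⊥ ⥲ D` for `D` of finitely connected type -/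

section Finite

variable {D : Type u} [Category.{v} D] [HasFiniteCoproducts D]

/-- Index sets of objects of `C^⊥` are finite. [cite: MochizukiFrdI2008, §0 p.16] -/
instance finite_index_finiteCoproductCompletion (X : FiniteCoproductCompletion.{w} C) :
    Finite X.obj.I := X.property

/-- In a category with finite coproducts, the members of an object of `(D⁰)^⊥` have a coproduct.
[cite: MochizukiFrdI2008, §0 p.16] -/
instance hasCoproduct_finiteCoproductCompletion
    (X : FiniteCoproductCompletion.{w} (ConnectedPart D)) :
    HasCoproduct fun i : X.obj.I => (X.obj.obj i).obj := inferInstance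

variable (D) in
/-- The natural functor `(D⁰)^⊥ → D`, `{Aᵢ} ↦ ∐ Aᵢ` (FrdI §0 p. 16). [cite: MochizukiFrdI2008, §0 p.16] -/
noncomputable abbrev ConnectedPart.glueFinite : FiniteCoproductCompletion.{w} (ConnectedPart D) ⥤ D :=
  ConnectedPart.glue (finiteFormalCoproducts.{w} (ConnectedPart D))

/-- **FrdI §0 p. 16: `(D⁰)^⊥ ⥲ D`** — for `D` of finitely connected type the gluing functor
`(D⁰)^⊥ → D` is an equivalence of categories: fully faithful by the third clause of "finitely connected
type" (`Hom(∐ Aᵢ, ∐ Bⱼ) = ∏ᵢ ∐ⱼ Hom(Aᵢ, Bⱼ)` when the `Aᵢ` are connected), essentially surjective by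
the second (every object is a finite coproduct of connected objects). [cite: MochizukiFrdI2008, §0 p.16] -/
theorem ConnectedPart.glueFinite_isEquivalence (hD : IsOfFinitelyConnectedType D) :
    (ConnectedPart.glueFinite.{w} D).IsEquivalence := by
  have hbij : ∀ (Y : FiniteCoproductCompletion.{w} (ConnectedPart D)) (B : D), IsConnectedObj B →
      Function.Bijective fun p : Σ j, (B ⟶ (Y.obj.obj j).obj) =>
        p.2 ≫ Sigma.ι (fun j : Y.obj.I => (Y.obj.obj j).obj) p.1 := fun Y B hB =>
    hD.bijective_of_finite (Cofan.mk _ (Sigma.ι fun j : Y.obj.I => (Y.obj.obj j).obj))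
      (coproductIsCoproduct _) B hB
  haveI := ConnectedPart.glue_faithful (finiteFormalCoproducts.{w} (ConnectedPart D))
    fun Y B hB => (hbij Y B hB).1
  haveI := ConnectedPart.glue_full (finiteFormalCoproducts.{w} (ConnectedPart D))
    fun Y B hB => (hbij Y B hB).2
  haveI : (ConnectedPart.glueFinite.{w} D).EssSurj := ⟨fun A => by
    obtain ⟨n, X, hX, c, ⟨hc⟩, ⟨e⟩⟩ := hD.exists_cofan A
    refine ConnectedPart.mem_essImage_glue_of_cofan _ (X ∘ ULift.down) (fun k => hX k.down)
      (Cofan.mk c.pt fun k : ULift.{w} (Fin n) => c.inj k.down)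
      ((Cofan.isColimitEquivOfEquiv Equiv.ulift c) hc) e ?_
    exact inferInstanceAs (Finite (ULift.{w} (Fin n)))⟩
  exact { }

/-- `(D⁰)^⊥ ≃ D` as the existence of an equivalence of categories. [cite: MochizukiFrdI2008, §0 p.16] -/
theorem nonempty_equivalence_finiteCoproductCompletion_connectedPart
    (hD : IsOfFinitelyConnectedType D) :
    Nonempty (FiniteCoproductCompletion.{w} (ConnectedPart D) ≌ D) :=
  haveI := ConnectedPart.glueFinite_isEquivalence.{w} hD
  ⟨(ConnectedPart.glueFinite.{w} D).asEquivalence⟩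

end Finite

/-! ### `(E⁰)^⊤ ⥲ E` for `E` of countably connected type -/

section Countable

variable {E : Type u} [Category.{v} E] [HasCountableCoproducts E]

/-- Index sets of objects of `C^⊤` are countable. [cite: MochizukiFrdI2008, §0 p.16] -/
instance countable_index_countableCoproductCompletion (X : CountableCoproductCompletion.{w} C) :
    Countable X.obj.I := X.property

/-- In a category with countable coproducts, the members of an object of `(E⁰)^⊤` have a coproduct.
[cite: MochizukiFrdI2008, §0 p.16] -/
instance hasCoproduct_countableCoproductCompletion
    (X : CountableCoproductCompletion.{w} (ConnectedPart E)) :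
    HasCoproduct fun i : X.obj.I => (X.obj.obj i).obj := inferInstance

variable (E) in
/-- The natural functor `(E⁰)^⊤ → E`, `{Aᵢ} ↦ ∐ Aᵢ` (FrdI §0 p. 16). [cite: MochizukiFrdI2008, §0 p.16] -/
noncomputable abbrev ConnectedPart.glueCountable :
    CountableCoproductCompletion.{w} (ConnectedPart E) ⥤ E :=
  ConnectedPart.glue (countableFormalCoproducts.{w} (ConnectedPart E))

/-- **FrdI §0 p. 16: `(E⁰)^⊤ ⥲ E`** — for `E` of countably connected type the gluing functor
`(E⁰)^⊤ → E` is an equivalence of categories. [cite: MochizukiFrdI2008, §0 p.16] -/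
theorem ConnectedPart.glueCountable_isEquivalence (hE : IsOfCountablyConnectedType E) :
    (ConnectedPart.glueCountable.{w} E).IsEquivalence := by
  have hbij : ∀ (Y : CountableCoproductCompletion.{w} (ConnectedPart E)) (B : E), IsConnectedObj B →
      Function.Bijective fun p : Σ j, (B ⟶ (Y.obj.obj j).obj) =>
        p.2 ≫ Sigma.ι (fun j : Y.obj.I => (Y.obj.obj j).obj) p.1 := fun Y B hB =>
    hE.bijective_of_countable (Cofan.mk _ (Sigma.ι fun j : Y.obj.I => (Y.obj.obj j).obj))
      (coproductIsCoproduct _) B hB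
  haveI := ConnectedPart.glue_faithful (countableFormalCoproducts.{w} (ConnectedPart E))
    fun Y B hB => (hbij Y B hB).1
  haveI := ConnectedPart.glue_full (countableFormalCoproducts.{w} (ConnectedPart E))
    fun Y B hB => (hbij Y B hB).2
  haveI : (ConnectedPart.glueCountable.{w} E).EssSurj := ⟨fun A => by
    obtain ⟨ι, hι, X, hX, c, ⟨hc⟩, ⟨e⟩⟩ := hE.exists_cofan A
    refine ConnectedPart.mem_essImage_glue_of_cofan _ (X ∘ ULift.down) (fun k => hX k.down)
      (Cofan.mk c.pt fun k : ULift.{w} ι => c.inj k.down)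
      ((Cofan.isColimitEquivOfEquiv Equiv.ulift c) hc) e ?_
    exact inferInstanceAs (Countable (ULift.{w} ι))⟩
  exact { }

/-- `(E⁰)^⊤ ≃ E` as the existence of an equivalence of categories. [cite: MochizukiFrdI2008, §0 p.16] -/
theorem nonempty_equivalence_countableCoproductCompletion_connectedPart
    (hE : IsOfCountablyConnectedType E) :
    Nonempty (CountableCoproductCompletion.{w} (ConnectedPart E) ≌ E) :=
  haveI := ConnectedPart.glueCountable_isEquivalence.{w} hE
  ⟨(ConnectedPart.glueCountable.{w} E).asEquivalence⟩

end Countable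

end Literature.AlgebraicGeometry.Frobenioids
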